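import Literature.Computability.QuantumComplexity.InnerProductEstimation
import HarnessLib

/-!
# Dequantized supervised clustering / nearest centroid (CGLLTW §4.2, Problem 4.5 and Corollary 4.6;
# Tang 2018, Theorem 3) — the flattened-tensor identity and the estimator's error mass

Chia, Gilyén, Li, Lin, Tang, Wang, *Sampling-based sublinear low-rank matrix arithmetic framework
for dequantizing quantum machine learning*, J. ACM 69(5):33 (2022) = arXiv:1910.06151 (held
text, §4.2 "Supervised clustering", p. 24 L61–80), dequantizing the quantum nearest-centroid
algorithm of Lloyd–Mohseni–Rebentrost 2013 "as first noted in" Tang, arXiv:1811.00414: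

> **Problem 4.5.** Given `SQ(M) ∈ ℝ^{n×d}`, `Q(w) ∈ ℝⁿ`, approximate `(wM)(wM)ᵀ` to additive `ε`
> error with probability at least `1 − δ`.
>
> **Corollary 4.6.** There is a classical algorithm to solve Problem 4.5 in
> `Õ(‖M‖_F⁴‖w‖⁴ ε⁻² log(1/δ))` time.

and Tang, *Quantum-inspired classical algorithms for principal component analysis and
supervised clustering* (arXiv:1811.00414 = PRL 127:060503), **Theorem 3** with its proof
(held text p. 7 L34–47), verbatim:

> **Theorem 3 (Classical Nearest-Centroid).** Suppose we are given `O(T)`-time `SQ(V) ∈ ℂ^{n×d}`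
> and `SQ(u) ∈ ℂ^d`. Then Algorithm 1 outputs a solution to Problem 1 in
> `O(T Z²/ε² log(1/δ))` time.
> *Proof.* […] use that `wMM†w† = ⟨a|b⟩` for `a, b` the flattened tensors
> `a := Σ_{i,j,k} M_{ji}‖M_{k,*}‖ |i⟩|j⟩|k⟩ = M ⊗ M̃`; `b := Σ_{i,j,k} (w_j w_k M_{ki}/‖M_{k,*}‖) |i⟩|j⟩|k⟩`.
> Given `O(T)`-time `SQ(M)` and `Q(w)`, we have `O(T)`-time `SQ(a)` and `Q(b)`: namely, we can
> sample from `a` by sampling `j` and `k` from `M̃`, and then sampling `i` from `M_{j,*}`. Thus, we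
> can apply Proposition (inner product estimation) to estimate `wᵀMᵀMw` to `ε` error with
> probability `1−δ` in `O(T ε⁻² log(1/δ))` time, using that `‖a‖ = ‖M‖_F²` and `‖b‖ = ‖w‖²`.

What is formalized (real matrices `M : Fin n × Fin d`, `w : Fin n → ℝ`, the tree's
`SampleQuery` vocabulary; the triple index `(i, j, k)` is flattened to `Fin (d·(n·n))` by the
explicit equivalence `flat` so that the tree's `Fin`-indexed inner-product estimator applies):

* the two flattened tensors `tensorA M` (`a`), `tensorB M w` (`b`) and the three printed facts
  `⟨a, b⟩ = ‖wM‖²` (`sum_tensorA_mul_tensorB`; `wM = Matrix.vecMul w M`; at rows with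
  `‖M_{k,*}‖ = 0` both sides of the summand vanish, so no non-degeneracy is needed),
  `‖a‖² = ‖M‖_F⁴` (`normSq_tensorA`) and `‖b‖² ≤ ‖w‖⁴` (`normSq_tensorB_le`; equality when every
  row of `M` is non-zero, the printed "`‖b‖ = ‖w‖²`");
* "we can sample from `a` by sampling `j` and `k` from `M̃`, and then `i` from `M_{j,*}`": the
  length-square law of `a` FACTORS as `𝒟_a(i,j,k) = 𝒟_{M̃}(j)·𝒟_{M_{j,*}}(i)·𝒟_{M̃}(k)`
  (`lengthSqDist_tensorA`, via the tree's `rowDist_mul_lengthSqDist`);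
* **Corollary 4.6 / Theorem 3 in mass form** (`supervised_clustering`): for `M ≠ 0`, with
  `x ≥ 8‖M‖_F⁴‖w‖⁴/ε²` samples per block and `q ≥ 8 ln(1/δ)` blocks, the median-of-means estimate
  built from i.i.d. samples of `𝒟_a` (the tree's `ipBlockMean` for the witness `SQ₁(a)`) is
  `ε`-far from `‖wM‖² = (wM)(wM)ᵀ` on an outcome set of `𝒟_a^{x·q}`-mass at most `δ` — the tree's
  `innerProductEstimation` (CGLLTW §3.2 / Tang 2019 Prop. 4.2) applied to `(a, b)`; sample count
  `x·q = O(‖M‖_F⁴‖w‖⁴ε⁻² log(1/δ))`, the printed bound (time = `T` per sample is bookkeeping and,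
  as everywhere in this directory, not modelled).

No named facts; everything stated is proved.  Real entries (`-- TODO(general form): ℂ`, as in
`SampleQueryAccess.lean`).

## References
* [ChiaEtAl2022] N.-H. Chia, A. Gilyén, T. Li, H.-H. Lin, E. Tang, C. Wang, J. ACM 69(5):33
  (2022), doi:10.1145/3549524 (arXiv:1910.06151, held `paper:arxiv-1910.06151` §4.2, Problem 4.5,
  Corollary 4.6, p. 24 L61–80).
* [Tang2021QPCA] E. Tang, Phys. Rev. Lett. 127:060503 (2021) = arXiv:1811.00414, Thm 3 and its
  proof (held `paper:arxiv-1811.00414` p. 7 L34–47).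
* S. Lloyd, M. Mohseni, P. Rebentrost, arXiv:1307.0411 — the quantum
  nearest-centroid algorithm being dequantized (Tang's Thm 2: `O(T Z/ε log(1/δ))`).
-/

noncomputable section

namespace Literature.Computability.QuantumComplexity

namespace SampleQuery

namespace SupervisedClustering

open Finset Matrix Literature.Computability.Complexity

variable {n d : ℕ}

/-! ### The flattened tensors -/

/-- The flattening of the triple index `(i, j, k) ∈ [d] × [n] × [n]` to `Fin (d·(n·n))`.
[cite: Tang2021QPCA, Thm 3 proof ("`|i⟩|j⟩|k⟩`")] -/
def flat : Fin d × (Fin n × Fin n) ≃ Fin (d * (n * n)) :=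
  (Equiv.prodCongr (Equiv.refl (Fin d)) finProdFinEquiv).trans finProdFinEquiv

/-- `a := Σ_{i,j,k} M_{ji} ‖M_{k,*}‖ |i⟩|j⟩|k⟩ = M ⊗ M̃`, flattened.
[cite: Tang2021QPCA, Thm 3 proof (definition of `a`)] -/
def tensorA (M : Matrix (Fin n) (Fin d) ℝ) : Fin (d * (n * n)) → ℝ := fun t =>
  M (flat.symm t).2.1 (flat.symm t).1 * Real.sqrt (normSq (M (flat.symm t).2.2))

/-- `b := Σ_{i,j,k} (w_j w_k M_{ki} / ‖M_{k,*}‖) |i⟩|j⟩|k⟩`, flattened (junk value `0` at rows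
with `‖M_{k,*}‖ = 0`, where `M_{ki} = 0` anyway). [cite: Tang2021QPCA, Thm 3 proof (definition of `b`)] -/
def tensorB (M : Matrix (Fin n) (Fin d) ℝ) (w : Fin n → ℝ) : Fin (d * (n * n)) → ℝ := fun t =>
  w (flat.symm t).2.1 * w (flat.symm t).2.2 * M (flat.symm t).2.2 (flat.symm t).1 /
    Real.sqrt (normSq (M (flat.symm t).2.2))

/-- Unflattening `a`. [cite: Tang2021QPCA, Thm 3 proof (definition of `a`)] -/
@[simp] theorem tensorA_flat (M : Matrix (Fin n) (Fin d) ℝ) (i : Fin d) (j k : Fin n) :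
    tensorA M (flat (i, (j, k))) = M j i * Real.sqrt (normSq (M k)) := by
  simp [tensorA]

/-- Unflattening `b`. [cite: Tang2021QPCA, Thm 3 proof (definition of `b`)] -/
@[simp] theorem tensorB_flat (M : Matrix (Fin n) (Fin d) ℝ) (w : Fin n → ℝ) (i : Fin d)
    (j k : Fin n) :
    tensorB M w (flat (i, (j, k))) = w j * w k * M k i / Real.sqrt (normSq (M k)) := by
  simp [tensorB]

/-- Sums over the flattened index are triple sums. [folklore] -/
private theorem sum_flat (f : Fin (d * (n * n)) → ℝ) :
    ∑ t, f t = ∑ i : Fin d, ∑ j : Fin n, ∑ k : Fin n, f (flat (i, (j, k))) := by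
  rw [← Equiv.sum_comp flat, Fintype.sum_prod_type, Finset.sum_congr rfl]
  intro i _
  rw [Fintype.sum_prod_type]

/-- A row of squared norm `0` vanishes entrywise. [folklore] -/
private theorem row_eq_zero_of_normSq {M : Matrix (Fin n) (Fin d) ℝ} {k : Fin n}
    (h : normSq (M k) = 0) (i : Fin d) : M k i = 0 := by
  have := (normSq_eq_zero_iff (M k)).1 h
  exact congrFun this i

/-- The summand identity behind `⟨a, b⟩ = ‖wM‖²`: `a(i,j,k)·b(i,j,k) = (w_j M_{ji})(w_k M_{ki})`
(both sides are `0` when the row `k` vanishes). [cite: Tang2021QPCA, Thm 3 proof ("`wMM†w† = ⟨a|b⟩`")] -/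
theorem tensorA_mul_tensorB (M : Matrix (Fin n) (Fin d) ℝ) (w : Fin n → ℝ) (i : Fin d)
    (j k : Fin n) :
    tensorA M (flat (i, (j, k))) * tensorB M w (flat (i, (j, k))) =
      (w j * M j i) * (w k * M k i) := by
  rw [tensorA_flat, tensorB_flat]
  rcases eq_or_ne (normSq (M k)) 0 with h0 | h0
  · simp [row_eq_zero_of_normSq h0 i]
  · have hs : Real.sqrt (normSq (M k)) ≠ 0 :=
      Real.sqrt_ne_zero'.2 (lt_of_le_of_ne (normSq_nonneg _) (Ne.symm h0))
    field_simp

/-- **`⟨a, b⟩ = (wM)(wM)ᵀ = ‖wM‖²`.** [cite: Tang2021QPCA, Thm 3 proof ("`wMM†w† = ⟨a|b⟩`")];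
[cite: ChiaEtAl2022, §4.2 (Problem 4.5: "approximate `(wM)(wM)^T`")] -/
theorem sum_tensorA_mul_tensorB (M : Matrix (Fin n) (Fin d) ℝ) (w : Fin n → ℝ) :
    ∑ t, tensorA M t * tensorB M w t = normSq (vecMul w M) := by
  rw [sum_flat]
  simp_rw [tensorA_mul_tensorB]
  unfold normSq
  refine Finset.sum_congr rfl fun i _ => ?_
  rw [vecMul, dotProduct, sq, Finset.sum_mul_sum]

/-- **`‖a‖² = ‖M‖_F⁴`.** [cite: Tang2021QPCA, Thm 3 proof ("using that `‖a‖ = ‖M‖_F²`")] -/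
theorem normSq_tensorA (M : Matrix (Fin n) (Fin d) ℝ) : normSq (tensorA M) = frobSq M ^ 2 := by
  unfold normSq
  rw [sum_flat]
  simp_rw [tensorA_flat, mul_pow, Real.sq_sqrt (normSq_nonneg _)]
  rw [sq, frobSq]
  have h1 : ∀ i : Fin d, ∀ j : Fin n, ∑ k : Fin n, M j i ^ 2 * normSq (M k) =
      M j i ^ 2 * ∑ k, normSq (M k) := fun i j => by rw [Finset.mul_sum]
  simp_rw [h1, ← Finset.sum_mul]
  congr 1
  rw [Finset.sum_comm]
  rfl

/-- **`‖b‖² ≤ ‖w‖⁴`** (with equality when every row of `M` is non-zero; the junk value at zero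
rows only lowers the norm). [cite: Tang2021QPCA, Thm 3 proof ("`‖b‖ = ‖w‖²`")] -/
theorem normSq_tensorB_le (M : Matrix (Fin n) (Fin d) ℝ) (w : Fin n → ℝ) :
    normSq (tensorB M w) ≤ normSq w ^ 2 := by
  rw [normSq, sum_flat]
  simp_rw [tensorB_flat]
  -- per (j,k): Σ_i (w_j w_k M_{ki}/‖M_k‖)² = w_j² w_k² · [‖M_k‖ ≠ 0] ≤ w_j² w_k²
  have hrow : ∀ j k : Fin n,
      ∑ i : Fin d, (w j * w k * M k i / Real.sqrt (normSq (M k))) ^ 2 ≤ w j ^ 2 * w k ^ 2 := by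
    intro j k
    rcases eq_or_ne (normSq (M k)) 0 with h0 | h0
    · have hz : ∀ i, M k i = 0 := row_eq_zero_of_normSq h0
      simp only [hz, mul_zero, zero_div, ne_eq, OfNat.ofNat_ne_zero, not_false_eq_true,
        zero_pow, Finset.sum_const_zero]
      positivity
    · simp_rw [div_pow, mul_pow, Real.sq_sqrt (normSq_nonneg (M k))]
      rw [← Finset.sum_div, ← Finset.mul_sum]
      change (w j ^ 2 * w k ^ 2) * normSq (M k) / normSq (M k) ≤ _
      rw [mul_div_assoc, div_self h0, mul_one]
  calc ∑ i : Fin d, ∑ j : Fin n, ∑ k : Fin n, (w j * w k * M k i / Real.sqrt (normSq (M k))) ^ 2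
      = ∑ j : Fin n, ∑ k : Fin n, ∑ i : Fin d,
          (w j * w k * M k i / Real.sqrt (normSq (M k))) ^ 2 := by
        rw [Finset.sum_comm]
        exact Finset.sum_congr rfl fun j _ => Finset.sum_comm
    _ ≤ ∑ j : Fin n, ∑ k : Fin n, w j ^ 2 * w k ^ 2 :=
        Finset.sum_le_sum fun j _ => Finset.sum_le_sum fun k _ => hrow j k
    _ = normSq w ^ 2 := by rw [normSq, sq, Finset.sum_mul_sum]

/-- `a ≠ 0` as soon as `M ≠ 0`. [cite: Tang2021QPCA, Thm 3 proof ("`‖a‖ = ‖M‖_F²`")] -/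
theorem tensorA_ne_zero {M : Matrix (Fin n) (Fin d) ℝ} (hM : M ≠ 0) : tensorA M ≠ 0 := by
  intro h
  apply hM
  have hn : normSq (tensorA M) = 0 := by rw [h]; exact (normSq_eq_zero_iff _).2 rfl
  rw [normSq_tensorA, sq_eq_zero_iff, frobSq] at hn
  have hrows := (Finset.sum_eq_zero_iff_of_nonneg fun k _ => normSq_nonneg (M k)).1 hn
  funext k i
  exact row_eq_zero_of_normSq (hrows k (Finset.mem_univ k)) i

/-! ### Sampling access to `a` from `SQ(M)`: the law factors -/

/-- "We can sample from `a` by sampling `j` and `k` from `M̃`, and then sampling `i` from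
`M_{j,*}`": `𝒟_a(i,j,k) = 𝒟_{M̃}(j) · 𝒟_{M_{j,*}}(i) · 𝒟_{M̃}(k)` (row-norm sampling twice and one
row sample). [cite: Tang2021QPCA, Thm 3 proof]; [cite: ChiaEtAl2022, Def. 2.9 (remark: sampling `(i,j)` with probability `|A(i,j)|²/‖A‖_F²`)] -/
theorem lengthSqDist_tensorA (M : Matrix (Fin n) (Fin d) ℝ) (i : Fin d) (j k : Fin n) :
    lengthSqDist (tensorA M) (flat (i, (j, k))) =
      rowDist M j * lengthSqDist (M j) i * rowDist M k := by
  rw [rowDist_mul_lengthSqDist, lengthSqDist, normSq_tensorA, tensorA_flat, rowDist, mul_pow,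
    Real.sq_sqrt (normSq_nonneg _)]
  rcases eq_or_ne (frobSq M) 0 with h0 | h0
  · simp [h0]
  · field_simp

/-! ### Corollary 4.6 / Theorem 3: the estimator's error mass -/

/-- **Dequantized supervised clustering (CGLLTW Cor. 4.6; Tang 2018 Thm 3), mass form.**  For
`M ≠ 0`, blocks of `x ≥ 8‖M‖_F⁴‖w‖⁴/ε²` i.i.d. samples of `𝒟_a` and `q ≥ 8 ln(1/δ)` blocks, ANY
median `med ω` of the block means of `Z = ‖a‖² a(t)b(t)/a(t)²` (the tree's `ipBlockMean` for the
witness `SQ₁(a)`) satisfies `|med ω − ‖wM‖²| < ε` except on outcomes of total `𝒟_a^{x q}`-weight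
`≤ δ`; `x·q = O(‖M‖_F⁴‖w‖⁴ε⁻² log(1/δ))` samples — the printed running time up to the per-sample
oracle cost `T`.
[cite: ChiaEtAl2022, §4.2 Cor. 4.6]; [cite: Tang2021QPCA, Thm 3] -/
theorem supervised_clustering (M : Matrix (Fin n) (Fin d) ℝ) (hM : M ≠ 0) (w : Fin n → ℝ)
    {x q : ℕ} (hx : 0 < x) (hq : 0 < q) {ε δ : ℝ} (hε : 0 < ε) (hδ : 0 < δ)
    (hxε : 8 * frobSq M ^ 2 * normSq w ^ 2 / ε ^ 2 ≤ x) (hqδ : 8 * Real.log (1 / δ) ≤ q)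
    (med : (Fin q → Fin x → Fin (d * (n * n))) → ℝ)
    (hmed : ∀ ω, IsMedian (fun i => ipBlockMean (OversamplingWitness.refl (tensorA M))
      (tensorB M w) (ω i)) (med ω)) :
    ∑ ω ∈ univ.filter (fun ω : Fin q → Fin x → Fin (d * (n * n)) =>
        ε ≤ |med ω - normSq (vecMul w M)|),
      ∏ i, iidWeight (lengthSqDist (tensorA M)) (ω i) ≤ δ := by
  have ha : tensorA M ≠ 0 := tensorA_ne_zero hM
  have hxε' : 8 * (1 : ℝ) * normSq (tensorA M) * normSq (tensorB M w) / ε ^ 2 ≤ x := by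
    refine le_trans ?_ hxε
    rw [mul_one, normSq_tensorA]
    have hb := normSq_tensorB_le M w
    have hpos : 0 ≤ 8 * frobSq M ^ 2 := by positivity
    exact div_le_div_of_nonneg_right (mul_le_mul_of_nonneg_left hb hpos) (sq_nonneg ε) |>.trans_eq'
      (by ring)
  have h := innerProductEstimation (OversamplingWitness.refl (tensorA M)) ha (tensorB M w) hx hq hε
    hδ hxε' hqδ med hmed
  simpa only [OversamplingWitness.refl_tilde, sum_tensorA_mul_tensorB] using h

end SupervisedClustering

end SampleQuery

end Literature.Computability.QuantumComplexity
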